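import Summits.BirchSwinnertonDyer.BirchSwinnertonDyer.Theorems.ThetaPartnerAtTwoSignedControlAtTwoShaThreeBaseOfNorm
import Literature.NumberTheory.GaloisRepresentations.NumberFieldCdTwoProofs
import Literature.NumberTheory.GaloisRepresentations.GaloisCohomologyCorestriction
import Literature.NumberTheory.GaloisRepresentations.ArtinRestriction
import Literature.NumberTheory.GaloisRepresentations.AbsDecompositionDegreeTransfer
import Literature.NumberTheory.GaloisRepresentations.LocalWeilDatum
import Mathlib.GroupTheory.IndexNormal
import HarnessLib

/-!
# K4 `SignedControlAtTwo`, base case of Milne I Thm. 4.10 (c)₃: the index-`2` subgroups `Γ_{F(√a)}`, `a` totally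
# negative, and the reduction of `hbase` to «real-trivial classes of `H²(F, T)` are norms from `F(√-1)`»

Route `ThetaPartnerAtTwo` (TP2), crux K4 `SignedControlAtTwo` (stmt-BirchSwinnertonDyer-20309), line `eulerchar` v12, stub
`stub_poitouTateThreeRealRat`; width seat `bsd-wall-tp2-p3-w2` gen 7 (`--supports stmt-BirchSwinnertonDyer-20309`, helper).
Continuation of `…ShaThreeBaseOfNorm` (the H³ → H² reduction of the lead's binder `hbase`).  For a number field `F`, `a ∈ F`
negative under every real embedding, and `α ∈ F̄` with `α² = a`, `α ∉ F`, the subgroup `S_α = Γ_{F(α)} = galFixing F F(α) ≤ Γ_F`: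

* §1 `index_galFixing_adjoin_eq_two`, `isOpen`/normality, `not_mem_galFixing_adjoin_of_isReal` (**the complex conjugation of
  `Γ_{F_w}`, `w` real, does not fix `α`**: under an embedding `F̄ → ℂ` over `w` making it complex conjugation, a fixed `α` would be
  real with `α² = a < 0`), `groupCdLE_two_galFixing_adjoin` (**`cd₂(S_α) ≤ 2`**: the fixed field of `S_α` is a totally complex
  number field — Serre II §4.4 Prop. 13, tree theorem `fieldCdLE_two_of_numberField_holds`, transported along `Γ_L ≃ₜ* S_α`).
* §2 **`realThree_injective_of_norm_imaginary`** — the base case of 4.10 (c)₃ for a TRIVIAL `Γ_F`-module `T` with `2T = 0`,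
  GRANTED the norm statement at `S = Γ_{F(√-1)}`: «every class of `H²(F, T)` vanishing at all real places lies in
  `cor(H²(Γ_{F(√-1)}, T))`» (for `-1` a square in `F` nothing is needed: `F` is then totally complex).

HONEST FRAMING: THEOREMS ONLY (no definition, no named fact, no `sorry`); the displayed norm statement is the H² residue of
`hbase`, attacked in the sibling files (`…ShaThreeBaseNorm*`); closes no item by itself; BSD is not proved by any of this.
References: [SerreGaloisCohomology1997] II §4.4 Prop. 13, II §6.1; [MilneADT2006] I Thm. 4.10 (c); [NeukirchANT1999] Ch. IV §1.
-/

set_option autoImplicit false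
-- the Theorems namespace of this sub repeats the summit name by design (D-0017 nested layout)
set_option linter.dupNamespace false

noncomputable section

open CategoryTheory Function NumberField Field
open _root_.TopRep _root_.ContRepresentation _root_.ContinuousCohomology
open Literature.NumberTheory.GaloisRepresentations
open Literature.NumberTheory.GaloisRepresentations.LocalWeilDatum

namespace Summit.BirchSwinnertonDyer.BirchSwinnertonDyer.Theorems.SignedEC.ShaThreeBase

/-! ## §1 The subgroup `Γ_{F(α)}`, `α² = a` totally negative -/

section Quadratic

variable {F : Type} [Field F] [NumberField F]

omit [NumberField F] in
/-- Every `α ∈ F̄` is integral over `F`. [folklore] -/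
theorem isIntegral_of_sq (α : AlgebraicClosure F) : IsIntegral F α :=
  (Algebra.IsAlgebraic.isAlgebraic (R := F) α).isIntegral

/-- **`[Γ_F : Γ_{F(α)}] = 2`** for `α² = a ∈ F`, `α ∉ F` (`[F(α) : F] = deg minpoly = 2` and the Krull correspondence).
[cite: NeukirchANT1999, Ch. IV §1] -/
theorem index_galFixing_adjoin_eq_two (a : F) (α : AlgebraicClosure F) (hα : α * α = algebraMap F _ a)
    (hαF : α ∉ (algebraMap F (AlgebraicClosure F)).range) :
    (galFixing F (IntermediateField.adjoin F {α})).index = 2 := by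
  have hint : IsIntegral F α := isIntegral_of_sq α
  have h1 : (galFixing F (IntermediateField.adjoin F {α})).index = Module.finrank F (IntermediateField.adjoin F {α}) :=
    (NeukirchUchidaProof.finrank_eq_index_fixingSubgroup_comap (IntermediateField.adjoin F {α})).symm
  rw [h1, IntermediateField.adjoin.finrank hint]
  have h2 : 2 ≤ (minpoly F α).natDegree := (minpoly.two_le_natDegree_iff hint).2 hαF
  -- `minpoly ∣ X² - a`, so the degree is at most `2`
  have hle : (minpoly F α).natDegree ≤ 2 := by
    have hp : (Polynomial.X ^ 2 - Polynomial.C a : Polynomial F) ≠ 0 :=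
      Polynomial.X_pow_sub_C_ne_zero (by norm_num) a
    have hroot : Polynomial.aeval α (Polynomial.X ^ 2 - Polynomial.C a : Polynomial F) = 0 := by
      rw [map_sub, Polynomial.aeval_X_pow, Polynomial.aeval_C, pow_two, hα, sub_self]
    have hdeg := minpoly.degree_le_of_ne_zero F α hp hroot
    rw [Polynomial.degree_X_pow_sub_C (by norm_num) a] at hdeg
    exact Polynomial.natDegree_le_iff_degree_le.2 hdeg
  omega

omit [NumberField F] in
/-- `Γ_{F(α)}` is open. [cite: NeukirchANT1999, Ch. IV §1] -/
theorem isOpen_galFixing_adjoin (α : AlgebraicClosure F) :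
    IsOpen (galFixing F (IntermediateField.adjoin F {α}) : Set (absoluteGaloisGroup F)) := by
  haveI := IntermediateField.adjoin.finiteDimensional (isIntegral_of_sq (F := F) α)
  exact isOpen_galFixing F _

omit [NumberField F] in
/-- **A complex conjugation does not fix `α`** (`α² = a` with `a` negative under every real embedding): the image in `Γ_F` of
the non-trivial element of `Γ_{F_w}`, `w` real, is not in `Γ_{F(α)}`.  Under an embedding `ι : F̄ → ℂ` over `w` with
`ι(c x) = conj (ι x)`, `c α = α` would make `ι α` real with `(ι α)² = w(a) < 0`. [cite: SerreGaloisCohomology1997, II §6.1] -/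
theorem not_mem_galFixing_adjoin_of_isReal (a : F) (α : AlgebraicClosure F) (hα : α * α = algebraMap F _ a)
    (hneg : ∀ φ : F →+* ℝ, φ a < 0) {w : InfinitePlace F} (hw : w.IsReal)
    {s : absoluteGaloisGroup w.Completion} (hs : s ≠ 1) :
    absGaloisRestrict F w.Completion s ∉ galFixing F (IntermediateField.adjoin F {α}) := by
  intro hmem
  have hfix : absGaloisRestrict F w.Completion s • α = α :=
    (mem_galFixing_iff F).1 hmem α (IntermediateField.mem_adjoin_simple_self F α)
  obtain ⟨ι, hι, hconj⟩ := isComplexConjugation_iff.1 (isComplexConjugationAt_absGaloisRestrict_of_ne_one hw hs)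
  have hreal : starRingEnd ℂ (ι α) = ι α := by rw [← hconj α, hfix]
  obtain ⟨r, hr⟩ := Complex.conj_eq_iff_real.1 hreal
  have hsq : (ι α) * (ι α) = ((InfinitePlace.embedding_of_isReal hw a : ℝ) : ℂ) := by
    rw [← map_mul, hα]
    exact RingHom.congr_fun hι a
  rw [hr, ← Complex.ofReal_mul] at hsq
  have h1 : r * r = InfinitePlace.embedding_of_isReal hw a := Complex.ofReal_injective hsq
  have h2 := hneg (InfinitePlace.embedding_of_isReal hw)
  nlinarith [mul_self_nonneg r]

/-- The image of `Γ_L → Γ_F`, `L = F̄^H`, is `H` itself when `H` is open and normal. [cite: NeukirchANT1999, Ch. IV §1] -/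
theorem range_absGaloisRestrict_fixedField_eq (H : Subgroup (absoluteGaloisGroup F)) [hn : H.Normal]
    (hH : IsOpen (H : Set (absoluteGaloisGroup F))) :
    (absGaloisRestrict F (IntermediateField.fixedField H : IntermediateField F (AlgebraicClosure F))).range = H := by
  obtain ⟨g, hg⟩ := exists_mem_range_absGaloisRestrict_fixedField_iff H hH
  ext γ
  refine (hg γ).trans ⟨fun h => ?_, fun h => ?_⟩
  · have := hn.conj_mem _ h g
    rwa [← mul_assoc, ← mul_assoc, mul_inv_cancel, one_mul, mul_inv_cancel_right] at this
  · have := hn.conj_mem _ h g⁻¹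
    rwa [inv_inv] at this

omit [NumberField F] in
/-- `α` lies in the fixed field of `Γ_{F(α)}`. [folklore] -/
theorem mem_fixedField_galFixing_adjoin (α : AlgebraicClosure F) :
    α ∈ (IntermediateField.fixedField (galFixing F (IntermediateField.adjoin F {α})) :
      IntermediateField F (AlgebraicClosure F)) := by
  rw [IntermediateField.mem_fixedField_iff]
  intro σ hσ
  exact (mem_galFixing_iff F).1 hσ α (IntermediateField.mem_adjoin_simple_self F α)

/-- **`cd₂(Γ_{F(α)}) ≤ 2`** for `α² = a` with `a` negative under every real embedding of `F`: the fixed field `L = F̄^{Γ_{F(α)}}`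
contains `α`, so has no real embedding; Serre II §4.4 Prop. 13 (`fieldCdLE_two_of_numberField_holds`) gives `cd₂(Γ_L) ≤ 2`,
transported along `Γ_L ≃ₜ* Γ_{F(α)}`. [cite: SerreGaloisCohomology1997, II §4.4 Prop. 13] -/
theorem groupCdLE_two_galFixing_adjoin (a : F) (α : AlgebraicClosure F) (hα : α * α = algebraMap F _ a)
    (hneg : ∀ φ : F →+* ℝ, φ a < 0) (hαF : α ∉ (algebraMap F (AlgebraicClosure F)).range) :
    GroupCdLE (galFixing F (IntermediateField.adjoin F {α})) 2 2 := by
  set H := galFixing F (IntermediateField.adjoin F {α}) with hHdef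
  have hHo : IsOpen (H : Set (absoluteGaloisGroup F)) := isOpen_galFixing_adjoin α
  haveI : H.Normal := Subgroup.normal_of_index_eq_two (index_galFixing_adjoin_eq_two a α hα hαF)
  set L : IntermediateField F (AlgebraicClosure F) := IntermediateField.fixedField H with hL
  haveI : FiniteDimensional F L := finiteDimensional_fixedField_of_isOpen H hHo
  haveI : CharZero L := charZero_of_injective_algebraMap (algebraMap F L).injective
  haveI : NumberField L :=
    { to_charZero := inferInstance
      to_finiteDimensional := Module.Finite.trans F L }
  -- `L` is totally complex: a real embedding would make `a` a square in `ℝ`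
  haveI : IsTotallyComplex L := by
    refine ⟨fun v => ?_⟩
    by_contra hv
    rw [InfinitePlace.not_isComplex_iff_isReal] at hv
    let φ : L →+* ℝ := InfinitePlace.embedding_of_isReal hv
    let αL : L := ⟨α, mem_fixedField_galFixing_adjoin α⟩
    have hsq : φ αL * φ αL = (φ.comp (algebraMap F L)) a := by
      rw [← map_mul, RingHom.comp_apply]
      congr 1
      exact Subtype.ext hα
    have h2 := hneg (φ.comp (algebraMap F L))
    nlinarith [mul_self_nonneg (φ αL)]
  haveI : Fact (Nat.Prime 2) := ⟨Nat.prime_two⟩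
  have hcd : FieldCdLE L 2 2 := fieldCdLE_two_of_numberField_holds L 2 (Or.inr inferInstance)
  let e : (absGaloisRestrict F L).range ≃ₜ* H :=
    { MulEquiv.subgroupCongr (range_absGaloisRestrict_fixedField_eq H hHo) with
      continuous_toFun := continuous_subtype_val.subtype_mk _
      continuous_invFun := continuous_subtype_val.subtype_mk _ }
  exact (hcd.of_continuousMulEquiv (absGaloisRangeEquiv F L)).of_continuousMulEquiv e

end Quadratic

/-! ## §2 `hbase` from the norm statement at `Γ_{F(√-1)}` -/

section Main

variable {F : Type} [Field F] [NumberField F]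
variable {T : Type} [AddCommGroup T] [TopologicalSpace T] [DiscreteTopology T]
variable (σT : DiscreteGaloisModule F T)

/-- If `-1` is a square in `F`, `F` is totally complex. [folklore] -/
theorem isTotallyComplex_of_sq_eq_neg_one {j : F} (hj : j * j = -1) : IsTotallyComplex F := by
  refine ⟨fun v => ?_⟩
  by_contra hv
  rw [InfinitePlace.not_isComplex_iff_isReal] at hv
  let φ : F →+* ℝ := InfinitePlace.embedding_of_isReal hv
  have h : φ j * φ j = -1 := by rw [← map_mul, hj, map_neg, map_one]
  nlinarith [mul_self_nonneg (φ j)]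

/-- **Base case of Milne I Thm. 4.10 (c)₃ from the norm statement at `Γ_{F(√-1)}`.**  Let `T` be a discrete `Γ_F`-module with
trivial action and `2T = 0`.  Suppose that for every `I ∈ F̄` with `I² = -1`, `I ∉ F`, every class of `H²(F, T)` vanishing at all
real places lies in `cor(H²(Γ_{F(I)}, T))`.  Then every class of `H³(F, T)` vanishing at all real places is `0`
(`…ShaThreeBaseOfNorm.realThree_injective_of_range_cor` at `S = Γ_{F(I)}`: open of index `2`, `cd₂ ≤ 2`, missed by the complex
conjugations; when `-1 ∈ F²`, `F` is totally complex and `cd₂(Γ_F) ≤ 2` suffices).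
[cite: MilneADT2006, Ch. I, Thm. 4.10 (c)] [cite: SerreGaloisCohomology1997, II §4.4 Prop. 13] -/
theorem realThree_injective_of_norm_imaginary (htriv : ∀ (x : absoluteGaloisGroup F) (t : T), σT x t = t)
    (h2 : ∀ t : T, 2 • t = 0)
    (hnorm : ∀ (I : AlgebraicClosure F), I * I = -1 → I ∉ (algebraMap F (AlgebraicClosure F)).range →
      ∀ [Fintype (absoluteGaloisGroup F ⧸ galFixing F (IntermediateField.adjoin F {I}))]
        [IsClosed (galFixing F (IntermediateField.adjoin F {I}) : Set (absoluteGaloisGroup F))],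
      ∀ y : galoisCohomology σT 2,
        (∀ w : InfinitePlace F, w.IsReal → galoisCohomology.localization σT (Sum.inl w) 2 y = 0) →
          y ∈ Set.range (cor (galFixing F (IntermediateField.adjoin F {I})) σT 2))
    (c : galoisCohomology σT 3)
    (hc : ∀ w : InfinitePlace F, w.IsReal → galoisCohomology.localization σT (Sum.inl w) 3 c = 0) : c = 0 := by
  classical
  obtain ⟨I, hI⟩ := IsAlgClosed.exists_eq_mul_self (-1 : AlgebraicClosure F)
  by_cases hIF : I ∈ (algebraMap F (AlgebraicClosure F)).range
  · -- `-1` is a square in `F`: `F` is totally complex, `cd₂(Γ_F) ≤ 2`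
    obtain ⟨j, hj⟩ := hIF
    have hjj : j * j = -1 := (algebraMap F (AlgebraicClosure F)).injective (by rw [map_mul, hj, ← hI, map_neg, map_one])
    haveI := isTotallyComplex_of_sq_eq_neg_one hjj
    haveI : Fact (Nat.Prime 2) := ⟨Nat.prime_two⟩
    exact realThree_eq_zero_of_groupCdLE σT h2 (fieldCdLE_two_of_numberField_holds F 2 (Or.inr inferInstance)) c
  · -- `S = Γ_{F(I)}`: open, index `2`, `cd₂ ≤ 2`, missed by the complex conjugations
    have hα : I * I = algebraMap F _ (-1) := by rw [map_neg, map_one, ← hI]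
    have hneg : ∀ φ : F →+* ℝ, φ (-1 : F) < 0 := fun φ => by rw [map_neg, map_one]; norm_num
    set S := galFixing F (IntermediateField.adjoin F {I}) with hSdef
    have hidx : S.index = 2 := index_galFixing_adjoin_eq_two (-1) I hα hIF
    have hSo : IsOpen (S : Set (absoluteGaloisGroup F)) := isOpen_galFixing_adjoin I
    haveI : Fintype (absoluteGaloisGroup F ⧸ S) := Subgroup.fintypeOfIndexNeZero (by rw [hidx]; norm_num)
    haveI : IsClosed (S : Set (absoluteGaloisGroup F)) := Subgroup.isClosed_of_isOpen S hSo
    exact realThree_injective_of_range_cor σT htriv h2 S hSo hidx (groupCdLE_two_galFixing_adjoin (-1) I hα hneg hIF)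
      (fun w hw s hs => not_mem_galFixing_adjoin_of_isReal (-1) I hα hneg hw hs) (hnorm I hI.symm hIF) c hc

end Main

end Summit.BirchSwinnertonDyer.BirchSwinnertonDyer.Theorems.SignedEC.ShaThreeBase

end
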